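import Mathlib.Geometry.Manifold.MFDeriv.Atlas
import Literature.Geometry.Symplectic.GromovR4RelEnd
import Literature.Topology.FourManifolds.ChartTransport

/-!
# Helper `helper_puncturedChartBall_endPackage` of line `stable-seam-host` for crux
`OrigamiFoldExistence` (item stmt-SmoothPoincare4-7844; brick R2 of the round-seam rung
"STUB 3 ⇐ GromovRecognitionRelEnd")

**The coordinate at infinity on a punctured chart ball.**  Let `S` be a compact smooth
4-manifold, `e : ℝ⁴ → S` a smooth embedding of the whole model space, `p := e 0` and
`M := S ∖ {p}` (the open submanifold `Literature.Geometry.Symplectic.punctured p`).  For a linear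
isometry `A` of `ℝ⁴`, a scale `κ > 0` and a radius `0 < r₀ ≤ 1` we construct

* `ψt : S → ℝ⁴`, `ψt = κ • A ∘ ι ∘ e⁻¹` on `e(ℝ⁴)` (`ι z = z / ‖z‖²` the inversion; `e⁻¹` is the
  smooth global chart `Φ` of
  `Literature.Topology.FourManifolds.exists_chart_of_isSmoothEmbedding`), and
* `χ : ℝ⁴ → M`, `χ z = e (ι (A⁻¹ (κ⁻¹ • z)))` for `z ≠ 0`,

and prove exactly the map clauses of the hypothesis list of Gromov's relative recognition theorem
`Literature.Geometry.Symplectic.gromov_recognitionR4_relEnd` for `ψ := ψt ∘ Subtype.val`,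
`K := {x : M | x ∉ e(B(0, r₀))}`, `R := κ / r₀`: `ψt (e y) = κ • A (ι y)`; `ψt` is `C^∞` with
bijective differential on `e(B(0,1) ∖ 0)`; the sub-ends `K ∪ {‖ψ‖ ≤ R'}` (`R' ≥ R`) are compact
(they are the complements in `M` of the punctured chart balls `e(B(0, κ/R') ∖ 0)`, closed in the
compact `S` because `e` is open, and avoiding `p`); `ψ` is `C^∞` on `Kᶜ` and maps it bijectively
onto `{z | R < ‖z‖}` with `C^∞` inverse `χ`.  Everything is elementary: `‖κ • A (ι y)‖ = κ / ‖y‖`,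
`ι ∘ ι = id`, the chain rule, and invariance of domain for the equidimensional embedding `e`
(tree: `Manifold.IsSmoothEmbedding.isOpenMap_of_finrank_eq`).  The model `ℝ⁴` is written
`EuclideanSpace ℝ (Fin 4)` throughout and `𝓘(ℝ, ℝ⁴)` is `𝓡 4`.

Sources: M. Gromov, *Pseudo holomorphic curves in symplectic manifolds*, Invent. Math. 82 (1985),
§0.3.C (the end `ι ∘ chart` of a punctured ball); D. McDuff, D. Salamon, *Introduction to
Symplectic Topology*, 3rd ed. (2017), Remark 4.5.2 (viii); folklore calculus.
-/

noncomputable section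

-- the prescribed namespace `Summit.<P>.<Sub>.…` duplicates `SmoothPoincare4` (P = Sub)
set_option linter.dupNamespace false

open scoped Manifold ContDiff Topology
open Set Function Metric
open Literature.Geometry.Symplectic

namespace Summit.SmoothPoincare4.SmoothPoincare4.Theorems.OrigamiFoldExistence.StableSeamHost

/-! ### The flat model `g = κ • A ∘ ι` and its inverse `g' = ι ∘ A⁻¹ ∘ (κ⁻¹ • ·)` -/

section Flat

variable (A : EuclideanSpace ℝ (Fin 4) ≃ₗᵢ[ℝ] EuclideanSpace ℝ (Fin 4)) {κ : ℝ}
  {g g' : EuclideanSpace ℝ (Fin 4) → EuclideanSpace ℝ (Fin 4)}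

/-- `‖κ • A (ι y)‖ = κ / ‖y‖` (also at the junk value `ι 0 = 0`). [folklore] -/
private theorem norm_coordInf (hg : ∀ y, g y = κ • A (inversion y)) (hκ : 0 < κ)
    (y : EuclideanSpace ℝ (Fin 4)) : ‖g y‖ = κ / ‖y‖ := by
  rw [hg, norm_smul, Real.norm_eq_abs, abs_of_pos hκ, LinearIsometryEquiv.norm_map,
    norm_inversion, div_eq_mul_inv]

/-- `‖ι (A⁻¹ (κ⁻¹ • z))‖ = κ / ‖z‖`. [folklore] -/
private theorem norm_coordInfInv (hg' : ∀ z, g' z = inversion (A.symm (κ⁻¹ • z))) (hκ : 0 < κ)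
    (z : EuclideanSpace ℝ (Fin 4)) : ‖g' z‖ = κ / ‖z‖ := by
  rw [hg', norm_inversion, LinearIsometryEquiv.norm_map, norm_smul, Real.norm_eq_abs,
    abs_of_pos (inv_pos.2 hκ), mul_inv, inv_inv, div_eq_mul_inv]

/-- `g' ∘ g = id` on all of `ℝ⁴` (`ι` is an involution, `A` an isometry). [folklore] -/
private theorem coordInfInv_coordInf (hg : ∀ y, g y = κ • A (inversion y))
    (hg' : ∀ z, g' z = inversion (A.symm (κ⁻¹ • z))) (hκ : κ ≠ 0)
    (y : EuclideanSpace ℝ (Fin 4)) : g' (g y) = y := by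
  rw [hg', hg, smul_smul, inv_mul_cancel₀ hκ, one_smul, LinearIsometryEquiv.symm_apply_apply,
    inversion_inversion]

/-- `g ∘ g' = id` on all of `ℝ⁴`. [folklore] -/
private theorem coordInf_coordInfInv (hg : ∀ y, g y = κ • A (inversion y))
    (hg' : ∀ z, g' z = inversion (A.symm (κ⁻¹ • z))) (hκ : κ ≠ 0)
    (z : EuclideanSpace ℝ (Fin 4)) : g (g' z) = z := by
  rw [hg, hg', inversion_inversion, LinearIsometryEquiv.apply_symm_apply, smul_smul,
    mul_inv_cancel₀ hκ, one_smul]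

/-- `g = κ • A ∘ ι` is `C^∞` away from the origin. [folklore] -/
private theorem contDiffAt_coordInf (hg : ∀ y, g y = κ • A (inversion y))
    {y : EuclideanSpace ℝ (Fin 4)} (hy : y ≠ 0) : ContDiffAt ℝ ∞ g y := by
  have h1 : ContDiffAt ℝ ∞ (A ∘ inversion) y :=
    A.contDiff.contDiffAt.comp y (contDiffAt_inversion hy)
  have h2 : g = fun y => κ • (A ∘ inversion) y := funext fun y => hg y
  rw [h2]
  exact h1.const_smul κ

/-- `g' = ι ∘ A⁻¹ ∘ (κ⁻¹ • ·)` is `C^∞` away from the origin. [folklore] -/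
private theorem contDiffAt_coordInfInv (hg' : ∀ z, g' z = inversion (A.symm (κ⁻¹ • z)))
    (hκ : κ ≠ 0) {z : EuclideanSpace ℝ (Fin 4)} (hz : z ≠ 0) : ContDiffAt ℝ ∞ g' z := by
  have h0 : A.symm (κ⁻¹ • z) ≠ 0 := by
    intro h
    have h' : κ⁻¹ • z = 0 := by simpa using h
    exact hz ((smul_eq_zero_iff_right (inv_ne_zero hκ)).1 h')
  have h1 : ContDiffAt ℝ ∞ (fun w : EuclideanSpace ℝ (Fin 4) => κ⁻¹ • w) z :=
    contDiffAt_id.const_smul κ⁻¹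
  have h2 : ContDiffAt ℝ ∞ (fun w : EuclideanSpace ℝ (Fin 4) => A.symm (κ⁻¹ • w)) z :=
    A.symm.contDiff.contDiffAt.comp z h1
  have h3 : ContDiffAt ℝ ∞ (inversion ∘ fun w : EuclideanSpace ℝ (Fin 4) => A.symm (κ⁻¹ • w)) z :=
    ContDiffAt.comp (g := inversion) (f := fun w : EuclideanSpace ℝ (Fin 4) => A.symm (κ⁻¹ • w)) z
      (contDiffAt_inversion h0) h2
  have h4 : g' = fun w => inversion (A.symm (κ⁻¹ • w)) := funext fun w => hg' w
  rw [h4]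
  exact h3

/-- The differential of `g = κ • A ∘ ι` at `y ≠ 0` is bijective: differentiate `g' ∘ g = id`
and `g ∘ g' = id` with the chain rule. [folklore] -/
private theorem bijective_fderiv_coordInf (hg : ∀ y, g y = κ • A (inversion y))
    (hg' : ∀ z, g' z = inversion (A.symm (κ⁻¹ • z))) (hκ : 0 < κ)
    {y : EuclideanSpace ℝ (Fin 4)} (hy : y ≠ 0) : Function.Bijective (fderiv ℝ g y) := by
  have hgy : g y ≠ 0 := by
    rw [← norm_ne_zero_iff, norm_coordInf A hg hκ]
    exact (div_pos hκ (norm_pos_iff.2 hy)).ne'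
  have h1 : HasFDerivAt g (fderiv ℝ g y) y :=
    ((contDiffAt_coordInf A hg hy).differentiableAt (by simp)).hasFDerivAt
  have h2 : HasFDerivAt g' (fderiv ℝ g' (g y)) (g y) :=
    ((contDiffAt_coordInfInv A hg' hκ.ne' hgy).differentiableAt (by simp)).hasFDerivAt
  have hleft : (fderiv ℝ g' (g y)).comp (fderiv ℝ g y) = ContinuousLinearMap.id ℝ _ := by
    have hc : HasFDerivAt (g' ∘ g) ((fderiv ℝ g' (g y)).comp (fderiv ℝ g y)) y := h2.comp y h1
    have hid : HasFDerivAt (g' ∘ g) (ContinuousLinearMap.id ℝ _) y := by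
      have : g' ∘ g = id := funext fun w => coordInfInv_coordInf A hg hg' hκ.ne' w
      rw [this]
      exact hasFDerivAt_id y
    exact hc.unique hid
  have hright : (fderiv ℝ g y).comp (fderiv ℝ g' (g y)) = ContinuousLinearMap.id ℝ _ := by
    have h1' : HasFDerivAt g (fderiv ℝ g y) (g' (g y)) := by
      rw [coordInfInv_coordInf A hg hg' hκ.ne']
      exact h1
    have hc : HasFDerivAt (g ∘ g') ((fderiv ℝ g y).comp (fderiv ℝ g' (g y))) (g y) :=
      h1'.comp (g y) h2
    have hid : HasFDerivAt (g ∘ g') (ContinuousLinearMap.id ℝ _) (g y) := by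
      have : g ∘ g' = id := funext fun w => coordInf_coordInfInv A hg hg' hκ.ne' w
      rw [this]
      exact hasFDerivAt_id (g y)
    exact hc.unique hid
  have hli : Function.LeftInverse (fderiv ℝ g' (g y)) (fderiv ℝ g y) := fun v => by
    simpa using congrArg (fun T : _ →L[ℝ] _ => T v) hleft
  have hri : Function.RightInverse (fderiv ℝ g' (g y)) (fderiv ℝ g y) := fun v => by
    simpa using congrArg (fun T : _ →L[ℝ] _ => T v) hright
  exact ⟨hli.injective, hri.surjective⟩

end Flat

/-! ### The registered helper -/

/-- **Coordinate at infinity on a punctured chart ball** (brick R2 of the round-seam rung of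
line `stable-seam-host`).  For a compact smooth 4-manifold `S`, a smooth embedding `e : ℝ⁴ → S`
of the model space, a linear isometry `A`, `κ > 0` and `0 < r₀ ≤ 1`, there are `ψt : S → ℝ⁴` with
`ψt (e y) = κ • A (ι y)` (`ι` the inversion) and `χ : ℝ⁴ → S ∖ {e 0}` such that, with
`ψ := ψt ∘ Subtype.val`, `K := {x | x ∉ e(B(0, r₀))}` and `R := κ / r₀`: `ψt` is `C^∞` with
bijective differential on `e(B(0, 1) ∖ 0)`; `K ∪ {‖ψ‖ ≤ R'}` is compact for `R' ≥ R`; `ψ` is `C^∞`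
on `Kᶜ`; `χ` is `C^∞` on `{R < ‖z‖}`; `ψ` maps `Kᶜ` bijectively onto `{R < ‖z‖}`; and `χ ∘ ψ = id`
on `Kᶜ` — literally the map hypotheses of
`Literature.Geometry.Symplectic.gromov_recognitionR4_relEnd` for `M := S ∖ {e 0}`.
Gromov 1985, §0.3.C; McDuff–Salamon 2017, Rem. 4.5.2 (viii). [folklore] -/
theorem helper_puncturedChartBall_endPackage :
    ∀ (S : Type) [TopologicalSpace S] [T2Space S] [SecondCountableTopology S] [CompactSpace S]
      [ChartedSpace (EuclideanSpace ℝ (Fin 4)) S] [IsManifold (𝓡 4) ∞ S]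
      (e : EuclideanSpace ℝ (Fin 4) → S)
      (A : EuclideanSpace ℝ (Fin 4) ≃ₗᵢ[ℝ] EuclideanSpace ℝ (Fin 4)) (κ r₀ : ℝ),
      Manifold.IsSmoothEmbedding (𝓡 4) (𝓡 4) ∞ e → 0 < κ → 0 < r₀ → r₀ ≤ 1 →
      ∃ (ψt : S → EuclideanSpace ℝ (Fin 4))
        (χ : EuclideanSpace ℝ (Fin 4) → (Literature.Geometry.Symplectic.punctured (e 0))),
        (∀ y : EuclideanSpace ℝ (Fin 4), y ≠ 0 → ‖y‖ < 1 →
          ψt (e y) = κ • A (Literature.Geometry.Symplectic.inversion y)) ∧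
        ContMDiffOn (𝓡 4) 𝓘(ℝ, EuclideanSpace ℝ (Fin 4)) ∞ ψt
          (e '' (Metric.ball (0 : EuclideanSpace ℝ (Fin 4)) 1 \ {0})) ∧
        (∀ x ∈ e '' (Metric.ball (0 : EuclideanSpace ℝ (Fin 4)) 1 \ {0}),
          Function.Bijective (mfderiv (𝓡 4) 𝓘(ℝ, EuclideanSpace ℝ (Fin 4)) ψt x)) ∧
        (∀ R' : ℝ, κ / r₀ ≤ R' →
          IsCompact ({x : (Literature.Geometry.Symplectic.punctured (e 0)) |
              x.1 ∉ e '' Metric.ball (0 : EuclideanSpace ℝ (Fin 4)) r₀} ∪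
            {x | ‖(ψt ∘ Subtype.val) x‖ ≤ R'})) ∧
        ContMDiffOn (𝓡 4) 𝓘(ℝ, EuclideanSpace ℝ (Fin 4)) ∞ (ψt ∘ Subtype.val)
          {x : (Literature.Geometry.Symplectic.punctured (e 0)) |
            x.1 ∉ e '' Metric.ball (0 : EuclideanSpace ℝ (Fin 4)) r₀}ᶜ ∧
        ContMDiffOn 𝓘(ℝ, EuclideanSpace ℝ (Fin 4)) (𝓡 4) ∞ χ
          (Metric.closedBall (0 : EuclideanSpace ℝ (Fin 4)) (κ / r₀))ᶜ ∧
        Set.BijOn (ψt ∘ Subtype.val)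
          {x : (Literature.Geometry.Symplectic.punctured (e 0)) |
            x.1 ∉ e '' Metric.ball (0 : EuclideanSpace ℝ (Fin 4)) r₀}ᶜ
          (Metric.closedBall (0 : EuclideanSpace ℝ (Fin 4)) (κ / r₀))ᶜ ∧
        (∀ x, x ∈ {x : (Literature.Geometry.Symplectic.punctured (e 0)) |
            x.1 ∉ e '' Metric.ball (0 : EuclideanSpace ℝ (Fin 4)) r₀}ᶜ →
          χ ((ψt ∘ Subtype.val) x) = x) := by
  intro S _ _ _ _ _ _ e A κ r₀ he hκ hr₀ _
  have hinj : Function.Injective e := he.isEmbedding.injective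
  have hopen : IsOpenMap e :=
    Literature.Topology.FourManifolds.Manifold.IsSmoothEmbedding.isOpenMap_of_finrank_eq he rfl
  -- the smooth global chart `Φ = e⁻¹` on `e(ℝ⁴)`
  obtain ⟨Φ, hΦt, hΦsymm, hΦsrc, hΦsm⟩ :=
    Literature.Topology.FourManifolds.exists_chart_of_isSmoothEmbedding he
  have hΦe : ∀ y, Φ (e y) = y := fun y => by
    have h := Φ.right_inv (show y ∈ Φ.target by rw [hΦt]; exact mem_univ y)
    rwa [hΦsymm] at h
  have heΦ : ∀ x ∈ range e, e (Φ x) = x := fun x hx => by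
    have h := Φ.left_inv (show x ∈ Φ.source by rw [hΦsrc]; exact hx)
    rwa [hΦsymm] at h
  have hΦne : ∀ x ∈ range e, x ≠ e 0 → Φ x ≠ 0 := fun x hx hx0 h0 =>
    hx0 (by rw [← heΦ x hx, h0])
  have hΦat : ∀ x ∈ range e, ContMDiffAt (𝓡 4) (𝓡 4) ∞ Φ x := fun x hx =>
    (hΦsm x (by rw [hΦsrc]; exact hx)).contMDiffAt
      (Φ.open_source.mem_nhds (by rw [hΦsrc]; exact hx))
  have hΦmd : Φ.MDifferentiable (𝓡 4) (𝓡 4) := by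
    refine ⟨hΦsm.mdifferentiableOn (by simp), ?_⟩
    have h : MDifferentiable (𝓡 4) (𝓡 4) Φ.symm := by
      rw [hΦsymm]
      exact he.contMDiff.mdifferentiable (by simp)
    exact h.mdifferentiableOn
  -- the flat model and its inverse (def-free)
  obtain ⟨g, hg⟩ : ∃ g : EuclideanSpace ℝ (Fin 4) → EuclideanSpace ℝ (Fin 4),
      ∀ y, g y = κ • A (inversion y) := ⟨_, fun _ => rfl⟩
  obtain ⟨g', hg'⟩ : ∃ g' : EuclideanSpace ℝ (Fin 4) → EuclideanSpace ℝ (Fin 4),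
      ∀ z, g' z = inversion (A.symm (κ⁻¹ • z)) := ⟨_, fun _ => rfl⟩
  -- the coordinate at infinity `ψt = g ∘ Φ` and its inverse `χ = e ∘ g'` (off `0`)
  obtain ⟨ψt, hψt⟩ : ∃ ψt : S → EuclideanSpace ℝ (Fin 4), ∀ x, ψt x = g (Φ x) :=
    ⟨_, fun _ => rfl⟩
  have hψfun : ψt = g ∘ Φ := funext fun x => hψt x
  have hψe : ∀ y, ψt (e y) = g y := fun y => by rw [hψt, hΦe]
  obtain ⟨y₁, hy₁⟩ := exists_ne (0 : EuclideanSpace ℝ (Fin 4))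
  have hx₁ : e y₁ ∈ punctured (e 0) := mem_punctured.2 fun h => hy₁ (hinj h)
  have hmemP : ∀ z : EuclideanSpace ℝ (Fin 4), z ≠ 0 → e (g' z) ∈ punctured (e 0) := by
    intro z hz
    refine mem_punctured.2 fun h => ?_
    have h1 : g' z = 0 := hinj h
    have h2 : ‖g' z‖ = κ / ‖z‖ := norm_coordInfInv A hg' hκ z
    rw [h1, norm_zero] at h2
    exact (div_pos hκ (norm_pos_iff.2 hz)).ne' h2.symm
  obtain ⟨χ, hχ⟩ : ∃ χ : EuclideanSpace ℝ (Fin 4) → punctured (e 0),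
      ∀ z, z ≠ 0 → (χ z).1 = e (g' z) := by
    classical
    exact ⟨fun z => if hz : z = 0 then ⟨e y₁, hx₁⟩ else ⟨e (g' z), hmemP z hz⟩,
      fun z hz => by simp only [dif_neg hz]⟩
  -- the sets `K` (complement of the punctured `r₀`-chart ball) and `T = {R < ‖z‖}`
  set K : Set (punctured (e 0)) := {x : (Literature.Geometry.Symplectic.punctured (e 0)) |
    x.1 ∉ e '' Metric.ball (0 : EuclideanSpace ℝ (Fin 4)) r₀} with hK
  set T : Set (EuclideanSpace ℝ (Fin 4)) :=
    (Metric.closedBall (0 : EuclideanSpace ℝ (Fin 4)) (κ / r₀))ᶜ with hT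
  have hKc : ∀ x : punctured (e 0), x ∈ Kᶜ ↔ ∃ y, ‖y‖ < r₀ ∧ y ≠ 0 ∧ e y = x.1 := by
    intro x
    simp only [hK, mem_compl_iff, mem_setOf_eq, not_not, mem_image, Metric.mem_ball,
      dist_zero_right]
    constructor
    · rintro ⟨y, hy, hyx⟩
      exact ⟨y, hy, fun h0 => (mem_punctured.1 x.2) (by rw [← hyx, h0]), hyx⟩
    · rintro ⟨y, hy, -, hyx⟩
      exact ⟨y, hy, hyx⟩
  have hmemT : ∀ z, z ∈ T ↔ κ / r₀ < ‖z‖ := fun z => by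
    simp only [hT, mem_compl_iff, Metric.mem_closedBall, dist_zero_right, not_le]
  have hR : 0 < κ / r₀ := div_pos hκ hr₀
  have hTne : ∀ z ∈ T, z ≠ 0 := fun z hz h0 => by
    rw [hmemT, h0, norm_zero] at hz
    exact lt_irrefl _ (hz.trans hR)
  -- smoothness of `ψt` on `e(ℝ⁴) ∖ {e 0}`
  have hψat : ∀ x ∈ range e, x ≠ e 0 → ContMDiffAt (𝓡 4) (𝓡 4) ∞ ψt x := by
    intro x hx hx0
    rw [hψfun]
    exact (contDiffAt_coordInf A hg (hΦne x hx hx0)).comp_contMDiffAt (hΦat x hx)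
  -- complements of punctured chart balls are compact
  have hcpt : ∀ ρ : ℝ, 0 < ρ → IsCompact {x : punctured (e 0) |
      x.1 ∉ e '' Metric.ball (0 : EuclideanSpace ℝ (Fin 4)) ρ} := by
    intro ρ hρ
    rw [Subtype.isCompact_iff]
    have himg : ((↑) : punctured (e 0) → S) '' {x : punctured (e 0) |
        x.1 ∉ e '' Metric.ball (0 : EuclideanSpace ℝ (Fin 4)) ρ} =
        (e '' Metric.ball (0 : EuclideanSpace ℝ (Fin 4)) ρ)ᶜ := by
      ext y
      constructor
      · rintro ⟨x, hx, rfl⟩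
        exact hx
      · intro hy
        have hy0 : y ≠ e 0 := fun h => hy ⟨0, Metric.mem_ball_self hρ, h.symm⟩
        exact ⟨⟨y, mem_punctured.2 hy0⟩, hy, rfl⟩
    rw [himg]
    exact ((hopen _ Metric.isOpen_ball).isClosed_compl).isCompact
  refine ⟨ψt, χ, ?_, ?_, ?_, ?_, ?_, ?_, ?_, ?_⟩
  · -- (1) the formula on the punctured unit chart ball
    intro y _ _
    rw [hψe, hg]
  · -- (2) smoothness of `ψt` on `e(B(0,1) ∖ 0)`
    rintro x ⟨y, ⟨-, hy0⟩, rfl⟩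
    exact (hψat (e y) (mem_range_self y) (fun h => hy0 (hinj h))).contMDiffWithinAt
  · -- (3) bijective differential: chain rule `D(g ∘ Φ) = Dg ∘ DΦ`, both factors invertible
    rintro x ⟨y, ⟨-, hy0⟩, rfl⟩
    have hx : e y ∈ range e := mem_range_self y
    have hx0 : e y ≠ e 0 := fun h => hy0 (hinj h)
    have hG : HasMFDerivAt (𝓡 4) (𝓡 4) g (Φ (e y)) (fderiv ℝ g (Φ (e y))) :=
      ((contDiffAt_coordInf A hg (hΦne _ hx hx0)).differentiableAt (by simp)).hasFDerivAt
        |>.hasMFDerivAt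
    have hF : HasMFDerivAt (𝓡 4) (𝓡 4) Φ (e y) (mfderiv (𝓡 4) (𝓡 4) Φ (e y)) :=
      ((hΦat _ hx).mdifferentiableAt (by simp)).hasMFDerivAt
    have h := (hG.comp (e y) hF).mfderiv
    rw [hψfun, h]
    exact (bijective_fderiv_coordInf A hg hg' hκ (hΦne _ hx hx0)).comp
      (hΦmd.mfderiv_bijective (by rw [hΦsrc]; exact hx))
  · -- (4) the sub-ends are co-compact
    intro R' hR'
    have hR'pos : 0 < R' := hR.trans_le hR'
    have hρ : 0 < κ / R' := div_pos hκ hR'pos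
    have hρr : κ / R' ≤ r₀ := (div_le_comm₀ hr₀ hR'pos).1 hR'
    convert hcpt (κ / R') hρ using 1
    ext x
    simp only [hK, mem_union, mem_setOf_eq, Function.comp_apply]
    constructor
    · rintro (hxK | hxR) ⟨y', hy', hy'x⟩
      · exact hxK ⟨y', Metric.ball_subset_ball hρr hy', hy'x⟩
      · have hy'0 : y' ≠ 0 := fun h0 => (mem_punctured.1 x.2) (by rw [← hy'x, h0])
        rw [← hy'x, hψe, norm_coordInf A hg hκ] at hxR
        have hlt : ‖y'‖ < κ / R' := by rwa [Metric.mem_ball, dist_zero_right] at hy'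
        have hge : κ / R' ≤ ‖y'‖ := (div_le_comm₀ (norm_pos_iff.2 hy'0) hR'pos).1 hxR
        exact (not_le.2 hlt) hge
    · intro hx
      by_cases hxK : x.1 ∈ e '' Metric.ball (0 : EuclideanSpace ℝ (Fin 4)) r₀
      · right
        obtain ⟨y, hy, hyx⟩ := hxK
        have hy0 : y ≠ 0 := fun h0 => (mem_punctured.1 x.2) (by rw [← hyx, h0])
        rw [← hyx, hψe, norm_coordInf A hg hκ]
        have hge : κ / R' ≤ ‖y‖ := not_lt.1 fun hlt =>
          hx ⟨y, by rwa [Metric.mem_ball, dist_zero_right], hyx⟩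
        exact (div_le_comm₀ (norm_pos_iff.2 hy0) hR'pos).2 hge
      · left
        exact hxK
  · -- (5) smoothness of `ψ = ψt ∘ val` on `Kᶜ`
    intro x hx
    obtain ⟨y, -, -, hyx⟩ := (hKc x).1 hx
    have h1 : ContMDiffAt (𝓡 4) (𝓡 4) ∞ ψt x.1 := hψat x.1 ⟨y, hyx⟩ (mem_punctured.1 x.2)
    exact (h1.comp x (contMDiff_subtype_val (I := 𝓡 4) (n := ∞)
      (U := punctured (e 0))).contMDiffAt).contMDiffWithinAt
  · -- (6) smoothness of `χ` on `{R < ‖z‖}` (into the open submanifold `S ∖ {e 0}`)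
    intro z hz
    have hz0 : z ≠ 0 := hTne z hz
    have h0 : ContMDiffAt (𝓡 4) (𝓡 4) ∞ (fun w => e (g' w)) z :=
      he.contMDiff.contMDiffAt.comp z (contDiffAt_coordInfInv A hg' hκ.ne' hz0).contMDiffAt
    rw [← ContMDiffWithinAt.subtypeVal_comp_iff]
    exact h0.contMDiffWithinAt.congr (fun w hw => hχ w (hTne w hw)) (hχ z hz0)
  · -- (7) `ψ` maps `Kᶜ` bijectively onto `{R < ‖z‖}`
    refine ⟨?_, ?_, ?_⟩
    · intro x hx
      obtain ⟨y, hy, hy0, hyx⟩ := (hKc x).1 hx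
      show ψt x.1 ∈ T
      rw [hmemT, ← hyx, hψe, norm_coordInf A hg hκ]
      exact div_lt_div_of_pos_left hκ (norm_pos_iff.2 hy0) hy
    · intro a ha b hb hab
      obtain ⟨ya, -, -, hya⟩ := (hKc a).1 ha
      obtain ⟨yb, -, -, hyb⟩ := (hKc b).1 hb
      have h1 : g ya = g yb := by
        have h := hab
        simp only [Function.comp_apply] at h
        rwa [← hya, ← hyb, hψe, hψe] at h
      have h2 : ya = yb := by
        rw [← coordInfInv_coordInf A hg hg' hκ.ne' ya, h1, coordInfInv_coordInf A hg hg' hκ.ne']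
      apply Subtype.ext
      rw [← hya, ← hyb, h2]
    · intro z hz
      have hz0 : z ≠ 0 := hTne z hz
      have hzpos : 0 < ‖z‖ := norm_pos_iff.2 hz0
      have hy : ‖g' z‖ < r₀ := by
        rw [norm_coordInfInv A hg' hκ]
        exact (div_lt_comm₀ hr₀ hzpos).1 ((hmemT z).1 hz)
      have hy0 : g' z ≠ 0 := by
        rw [← norm_ne_zero_iff, norm_coordInfInv A hg' hκ]
        exact (div_pos hκ hzpos).ne'
      refine ⟨⟨e (g' z), hmemP z hz0⟩, (hKc _).2 ⟨g' z, hy, hy0, rfl⟩, ?_⟩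
      show ψt (e (g' z)) = z
      rw [hψe, coordInf_coordInfInv A hg hg' hκ.ne']
  · -- (8) `χ ∘ ψ = id` on `Kᶜ`
    intro x hx
    obtain ⟨y, -, hy0, hyx⟩ := (hKc x).1 hx
    have hgy0 : g y ≠ 0 := by
      rw [← norm_ne_zero_iff, norm_coordInf A hg hκ]
      exact (div_pos hκ (norm_pos_iff.2 hy0)).ne'
    apply Subtype.ext
    show (χ (ψt x.1)).1 = x.1
    rw [← hyx, hψe, hχ (g y) hgy0, coordInfInv_coordInf A hg hg' hκ.ne']

end Summit.SmoothPoincare4.SmoothPoincare4.Theorems.OrigamiFoldExistence.StableSeamHost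

end
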